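import Mathlib
import HarnessLib
import Literature.AlgebraicGeometry.Resolution.ResolutionLocalization
import Literature.AlgebraicGeometry.Resolution.ResolutionOfIsoLocus
import Literature.AlgebraicGeometry.Resolution.AlterationsResolution
import Literature.AlgebraicGeometry.Resolution.BirationalLocalIso
import Summits.ResolutionOfSingularities.ResolutionOfSingularities.Theorems.HomologicalConductorSurfaceTerminationChartResolution

/-!
# Route `HomologicalConductor`, kill test `SurfaceTermination` (stmt-ResolutionOfSingularities-16488):
# the chart dictionary of a resolution, part 3 — the chart morphism is birational, and its localisation
# at the next centre is a resolution of the next stage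

OURS (cell res-hironaka, crux chain W4.4, seat res-L0-w44-stub-1; object U2a «chart dictionary» (K2) of
res-D-pv-045's programme `stub_pgNonincreasing`; res-L0-w44-plan-1 (ρ13a)); nothing here is a statement of
the manuscript under review (Hironaka 2017); AI-written, weaker than expert review.  SUPPORT-level, counted 0.

Continuing parts 1–2 (`…ChartSections`, `…ChartResolution`; notation there: `T ⊆ K`, `I`, `x ∈ I`,
`ρ : Z ⟶ Spec T`, `σ_B : Z ⟶ Bl_I(Spec T)`, `V = σ_B⁻¹(D₊(xt))`, `C = k[T ∪ I·x⁻¹]`, `N ⊇ C`):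

* §1 DENOMINATORS: for `T` integrally closed with `Frac T = K`, every element of `nrm C` becomes an element of
  `T` after multiplication by a power of `x` (`nrm C ⊆ T[1/x]`, a localisation of a normal domain being
  normal) — `exists_pow_mul_mem_of_mem_nrm_adjoin`;
* §2 BIRATIONALITY: if `ρ` is birational and `N ⊆ T[1/x]` in the above sense, any `σ : V ⟶ Spec N` over
  `Spec T` is birational — over `D(t·x)`, with `D(t)` an open over which `ρ` is an isomorphism, both
  `Spec N → Spec T` and `V.ι ≫ ρ` are isomorphisms (`isBirational_of_comp_eq`);
* §3 LOCALISATION: the base change of a resolution `X' ⟶ Spec B` along `Spec S ⟶ Spec B`, `S` a localisation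
  of the domain `B`, is a resolution of `Spec S` (the tree's `ResolutionLocalization`, non-`∃` form:
  `isResolution_pullback_snd_of_isLocalization`) — for `B = N = nrm C`, `S = loc O N = T_(m+2)` (tree
  `PersistenceRadicalTower.tower_succ_eq_loc_nrm_affChart`, `SyzygyFlattening.isLocalization_locAt`) this is
  the resolution `Z' = V ×_N Spec T_(m+2) ⟶ Spec T_(m+2)` consumed by U2e, in the binder shape of U2b
  (`CechLocalization.isLocalizedModule_cechComapH1`: `fX := σ`, `fY' := pullback.snd`, `g := pullback.fst`);
* §5 ASSEMBLY `exists_isResolution_chartMorphism`: for a resolution `ρ` (and `T` integrally closed, `Frac T = K`)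
  the chart morphism `σ : V ⟶ Spec (nrm C)` is a RESOLUTION of `Spec (nrm C)` over `Spec T`;
* §6 the bridge between the generator sets `{c · x⁻¹ : c ∈ ca T}` (the tree's tower vocabulary, `ca T ⊆ K`)
  and `{c · x⁻¹ : c ∈ cohomologyAnnihilator ↥T}` (the ideal used for `affineBlowup`) — `setOf_ca_mul_inv_eq`.

Def-free.

References: The Stacks Project, Tags 0804, 01RN, 0BAC [`StacksProject`]; A. Grothendieck, EGA IV₃ (1966)
8.10.5 [`EGAIV3`]; O. Zariski, P. Samuel, *Commutative Algebra* II (1960), Ch. VI §17 [`ZariskiSamuel1960`].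
-/

noncomputable section

-- single-problem summit: the doubled namespace component `ResolutionOfSingularities` is forced
set_option linter.dupNamespace false

namespace Summit.ResolutionOfSingularities.ResolutionOfSingularities.Theorems.SurfaceTermination.ChartResolution

open CategoryTheory CategoryTheory.Limits AlgebraicGeometry TopologicalSpace Opposite
open Literature.AlgebraicGeometry.Resolution Literature.AlgebraicGeometry.Motives
open Literature.AlgebraicGeometry.Morphisms
open Summit.ResolutionOfSingularities.ResolutionOfSingularities.Theorems.NoZeno.Birth
open Summit.ResolutionOfSingularities.ResolutionOfSingularities.Theorems.NoZeno.SandwichCluster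

variable {k K : Type} [Field k] [Field K] [Algebra k K]

/-! ## §1 Denominators: `nrm (k[T ∪ I·x⁻¹]) ⊆ T[1/x]` -/

section Denominators

variable (T : Subalgebra k K) {I : Ideal ↥T} {x : ↥T}

/-- **`k[T ∪ I·x⁻¹] ⊆ T[1/x]`**: every element of the affine chart ring becomes an element of `T` after
multiplication by a power of `x`. [folklore] -/
theorem exists_pow_mul_mem_of_mem_adjoin {y : K}
    (hy : y ∈ Algebra.adjoin k ((T : Set K) ∪ {y : K | ∃ c : ↥T, c ∈ I ∧ y = (c : K) * (x : K)⁻¹}))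
    (hx0 : (x : K) ≠ 0) :
    ∃ m : ℕ, (x : K) ^ m * y ∈ T := by
  induction hy using Algebra.adjoin_induction with
  | mem y hy =>
    rcases hy with hy | ⟨c, -, rfl⟩
    · exact ⟨0, by rw [pow_zero, one_mul]; exact hy⟩
    · refine ⟨1, ?_⟩
      rw [pow_one, mul_left_comm, mul_inv_cancel₀ hx0, mul_one]
      exact c.2
  | algebraMap r => exact ⟨0, by rw [pow_zero, one_mul]; exact T.algebraMap_mem r⟩
  | add a b _ _ ha hb =>
    obtain ⟨m, hm⟩ := ha
    obtain ⟨n, hn⟩ := hb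
    refine ⟨m + n, ?_⟩
    have : (x : K) ^ (m + n) * (a + b) = (x : K) ^ n * ((x : K) ^ m * a) + (x : K) ^ m * ((x : K) ^ n * b) := by
      ring
    rw [this]
    exact T.add_mem (T.mul_mem (T.pow_mem x.2 n) hm) (T.mul_mem (T.pow_mem x.2 m) hn)
  | mul a b _ _ ha hb =>
    obtain ⟨m, hm⟩ := ha
    obtain ⟨n, hn⟩ := hb
    refine ⟨m + n, ?_⟩
    have : (x : K) ^ (m + n) * (a * b) = ((x : K) ^ m * a) * ((x : K) ^ n * b) := by ring
    rw [this]
    exact T.mul_mem hm hn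

/-- **`nrm (k[T ∪ I·x⁻¹]) ⊆ T[1/x]` for `T` integrally closed with `Frac T = K`**: an element of `K`
integral over the affine chart ring `C ⊆ T[1/x]` is integral over the localisation `T[1/x]`, which is
integrally closed (Mathlib `isIntegrallyClosed_of_isLocalization`), hence lies in `T[1/x]`; the
normalisation `nrm C = k[{y | y integral over C}]` is then inside `T[1/x]` too.
[cite: ZariskiSamuel1960, Ch. VI §17] -/
theorem exists_pow_mul_mem_of_mem_nrm_adjoin [IsIntegrallyClosed ↥T] [IsFractionRing ↥T K]
    (hx0 : (x : K) ≠ 0) {y : K}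
    (hy : y ∈ nrm (Algebra.adjoin k ((T : Set K) ∪ {y : K | ∃ c : ↥T, c ∈ I ∧ y = (c : K) * (x : K)⁻¹}))) :
    ∃ m : ℕ, (x : K) ^ m * y ∈ T := by
  have hx0' : x ≠ 0 := fun h => hx0 (by rw [h]; rfl)
  have hS : Submonoid.powers x ≤ nonZeroDivisors ↥T := powers_le_nonZeroDivisors_of_noZeroDivisors hx0'
  -- `T[1/x] ⊆ K`
  let Tx : Subalgebra ↥T K := Localization.subalgebra.ofField K (Submonoid.powers x) hS
  haveI : IsLocalization (Submonoid.powers x) ↥Tx := Localization.subalgebra.isLocalization_ofField K _ hS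
  haveI : IsIntegrallyClosed ↥Tx := isIntegrallyClosed_of_isLocalization (R := ↥T) ↥Tx _ hS
  haveI : IsFractionRing ↥Tx K :=
    IsFractionRing.isFractionRing_of_isDomain_of_isLocalization (Submonoid.powers x) ↥Tx K
  -- membership in `T[1/x]` means: a power of `x` clears the denominator
  have hTx : ∀ z : K, z ∈ Tx → ∃ m : ℕ, (x : K) ^ m * z ∈ T := by
    rintro z ⟨a, s, hs, rfl⟩
    obtain ⟨m, rfl⟩ := (Submonoid.mem_powers_iff _ _).mp hs
    refine ⟨m, ?_⟩
    have hxm : (algebraMap ↥T K (x ^ m)) = (x : K) ^ m := by rw [map_pow]; rfl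
    rw [hxm, mul_left_comm, mul_inv_cancel₀ (pow_ne_zero m hx0), mul_one]
    exact a.2
  have hTx' : ∀ z : K, (∃ m : ℕ, (x : K) ^ m * z ∈ T) → z ∈ Tx := by
    rintro z ⟨m, hm⟩
    refine ⟨⟨_, hm⟩, x ^ m, ⟨m, rfl⟩, ?_⟩
    have hxm : (algebraMap ↥T K (x ^ m)) = (x : K) ^ m := by rw [map_pow]; rfl
    rw [hxm]
    change z = (x : K) ^ m * z * ((x : K) ^ m)⁻¹
    rw [mul_comm ((x : K) ^ m) z, mul_assoc, mul_inv_cancel₀ (pow_ne_zero m hx0), mul_one]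
  -- the chart ring lies in `T[1/x]`
  have hC : ∀ z ∈ Algebra.adjoin k ((T : Set K) ∪ {y : K | ∃ c : ↥T, c ∈ I ∧ y = (c : K) * (x : K)⁻¹}),
      z ∈ Tx := fun z hz => hTx' z (exists_pow_mul_mem_of_mem_adjoin T hz hx0)
  -- elements integral over the chart ring lie in `T[1/x]`
  have hint : ∀ z : K, IsIntegral ↥(Algebra.adjoin k ((T : Set K) ∪
      {y : K | ∃ c : ↥T, c ∈ I ∧ y = (c : K) * (x : K)⁻¹})) z → z ∈ Tx := by
    rintro z ⟨p, hp, hpz⟩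
    let φ : ↥(Algebra.adjoin k ((T : Set K) ∪ {y : K | ∃ c : ↥T, c ∈ I ∧ y = (c : K) * (x : K)⁻¹})) →+* ↥Tx :=
      { toFun := fun c => ⟨c.1, hC c.1 c.2⟩
        map_one' := rfl
        map_mul' := fun _ _ => rfl
        map_zero' := rfl
        map_add' := fun _ _ => rfl }
    have hz : IsIntegral ↥Tx z := by
      refine ⟨p.map φ, hp.map _, ?_⟩
      have hcomp : (algebraMap ↥Tx K).comp φ = algebraMap _ K := RingHom.ext fun _ => rfl
      rw [Polynomial.eval₂_map, hcomp]
      exact hpz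
    obtain ⟨w, hw⟩ := (IsIntegrallyClosed.isIntegral_iff (R := ↥Tx) (K := K)).mp hz
    rw [← hw]
    exact w.2
  -- and so does the normalisation
  suffices h : y ∈ Tx from hTx y h
  revert hy
  refine fun hy => ?_
  induction hy using Algebra.adjoin_induction with
  | mem z hz => exact hint z hz
  | algebraMap r =>
    exact hTx' _ ⟨0, by rw [pow_zero, one_mul]; exact T.algebraMap_mem r⟩
  | add a b _ _ ha hb => exact Tx.add_mem ha hb
  | mul a b _ _ ha hb => exact Tx.mul_mem ha hb

end Denominators

/-! ## §2 Birationality of the chart morphism -/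

section Birational

variable (T : Subalgebra k K) {Z : Scheme.{0}} [IsIntegral Z] (ρ : Z ⟶ Spec (.of ↥T))
  {I : Ideal ↥T} (σB : Z ⟶ affineBlowup I) (hσB : σB ≫ affineBlowup.π I = ρ)
  {x : ↥T} (hxI : x ∈ I)

include hσB in
/-- **The chart morphism is birational.**  Let `ρ` be birational, `N ⊇ T` a `k`-subalgebra of `K` every
element of which becomes an element of `T` after multiplication by a power of `x` (`N ⊆ T[1/x]`, e.g.
`N = nrm (k[T ∪ I·x⁻¹])` for `T` integrally closed, §1), and `σ : V ⟶ Spec N` a morphism over `Spec T`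
from `V = σ_B⁻¹(D₊(xt))`.  Then `σ` is birational: choose `0 ≠ t ∈ T` with `ρ` an isomorphism over `D(t)`;
over `D(tx)` the morphism `Spec N → Spec T` is an isomorphism (`N[1/tx] = T[1/tx]`, a common denominator)
and so is `V.ι ≫ ρ` (`ρ⁻¹(D(x)) ⊆ V`); hence `σ` is an isomorphism over the preimage of `D(tx)` in
`Spec N`, a dense open with dense preimage. [cite: StacksProject, Tag 01RN] -/
theorem isBirational_of_comp_eq (hρ : IsBirational ρ) (hx0 : (x : K) ≠ 0)
    (N : Subalgebra k K) (hTN : T ≤ N) (hden : ∀ y ∈ N, ∃ m : ℕ, (x : K) ^ m * y ∈ T)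
    (σ : ((σB ⁻¹ᵁ (affineBlowup.chartOpen x hxI).1 : Z.Opens) : Scheme.{0}) ⟶ Spec (.of ↥N))
    (hσ : (σB ⁻¹ᵁ (affineBlowup.chartOpen x hxI).1).ι ≫ ρ =
      σ ≫ Spec.map (CommRingCat.ofHom (Subalgebra.inclusion hTN).toRingHom)) :
    IsBirational σ := by
  classical
  have hx0' : x ≠ 0 := fun h => hx0 (by rw [h]; rfl)
  -- notation: `ν : Spec N → Spec T`, the `T`-algebra `N`
  letI : Algebra ↥T ↥N := (Subalgebra.inclusion hTN).toRingHom.toAlgebra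
  have halg : algebraMap ↥T ↥N = (Subalgebra.inclusion hTN).toRingHom := rfl
  have hinj : Function.Injective (algebraMap ↥T ↥N) := Subalgebra.inclusion_injective hTN
  -- an open `D(t) ∋ η` over which `ρ` is an isomorphism
  obtain ⟨U, hU, hU', hiso⟩ := hρ
  haveI := hiso
  haveI : IrreducibleSpace (Spec (.of ↥T) : Scheme.{0}) :=
    inferInstanceAs (IrreducibleSpace (PrimeSpectrum ↥T))
  have hηU : genericPoint (Spec (.of ↥T)) ∈ (U : Set (Spec (.of ↥T))) :=
    genericPoint_mem_of_isOpen U.2 hU.nonempty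
  obtain ⟨W, hW, hηt, htU⟩ := (PrimeSpectrum.isBasis_basic_opens (R := ↥T)).exists_subset_of_mem_open
    hηU U.2
  obtain ⟨W', ⟨t, rfl⟩, rfl⟩ := hW
  have htU : PrimeSpectrum.basicOpen t ≤ (U : (Spec (.of ↥T)).Opens) := fun p hp => htU hp
  have ht0 : t ≠ 0 := by
    intro h
    have : t ∈ (genericPoint (Spec (.of ↥T)) : PrimeSpectrum ↥T).asIdeal := by
      rw [h]; exact Ideal.zero_mem _
    exact hηt this
  -- the open `D(t x)` and its preimages
  have htx0 : t * x ≠ 0 := mul_ne_zero ht0 hx0'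
  have hle_t : PrimeSpectrum.basicOpen (t * x) ≤ (U : (Spec (.of ↥T)).Opens) :=
    (PrimeSpectrum.basicOpen_mul_le_left t x).trans htU
  have hle_x : PrimeSpectrum.basicOpen (t * x) ≤ (PrimeSpectrum.basicOpen x : (Spec (.of ↥T)).Opens) :=
    PrimeSpectrum.basicOpen_mul_le_right t x
  haveI hisoρ : IsIso (ρ ∣_ PrimeSpectrum.basicOpen (t * x)) := isIso_morphismRestrict_of_le ρ hle_t
  -- (A) `Spec N → Spec T` is an isomorphism over `D(t x)`: `N[1/tx] = T[1/tx]`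
  have hB : ∀ b : ↥N, ∃ n : ℕ, ∃ a : ↥T,
      algebraMap ↥T ↥N a = algebraMap ↥T ↥N (t * x) ^ n * b := by
    intro b
    obtain ⟨m, hm⟩ := hden b b.2
    refine ⟨m, ⟨(t : K) ^ m * ((x : K) ^ m * (b : K)), T.mul_mem (T.pow_mem t.2 m) hm⟩, Subtype.ext ?_⟩
    rw [halg]
    change (t : K) ^ m * ((x : K) ^ m * (b : K)) =
      (((Subalgebra.inclusion hTN (t * x) : ↥N) ^ m * b : ↥N) : K)
    rw [MulMemClass.coe_mul, SubmonoidClass.coe_pow, Subalgebra.coe_inclusion, MulMemClass.coe_mul]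
    ring
  let S := Localization.Away (algebraMap ↥T ↥N (t * x))
  haveI : IsLocalization.Away (t * x) S := isLocalizationAway_of_denominator hinj (t * x) htx0 hB
  let ν : Spec (.of ↥N) ⟶ Spec (.of ↥T) := Spec.map (CommRingCat.ofHom (algebraMap ↥T ↥N))
  have hν : ν = Spec.map (CommRingCat.ofHom (Subalgebra.inclusion hTN).toRingHom) := rfl
  let j : Spec (.of S) ⟶ Spec (.of ↥N) := Spec.map (CommRingCat.ofHom (algebraMap ↥N S))
  have hjν : j ≫ ν = Spec.map (CommRingCat.ofHom (algebraMap ↥T S)) := by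
    change Spec.map _ ≫ Spec.map _ = _
    rw [← Spec.map_comp, ← CommRingCat.ofHom_comp, ← IsScalarTower.algebraMap_eq ↥T ↥N S]
  haveI : IsOpenImmersion j := IsOpenImmersion.of_isLocalization (algebraMap ↥T ↥N (t * x))
  haveI : IsOpenImmersion (j ≫ ν) := by rw [hjν]; exact IsOpenImmersion.of_isLocalization (t * x)
  haveI hisoν : IsIso (ν ∣_ PrimeSpectrum.basicOpen (t * x)) := by
    refine isIso_morphismRestrict_of_isOpenImmersion ν _ j ?_ ?_
    · change Set.range j = ((Spec.map (CommRingCat.ofHom (algebraMap ↥T ↥N)) ⁻¹ᵁ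
        PrimeSpectrum.basicOpen (t * x) : (Spec (.of ↥N)).Opens) : Set (Spec (.of ↥N)))
      rw [SpecMap_preimage_basicOpen]
      exact PrimeSpectrum.localization_away_comap_range S (algebraMap ↥T ↥N (t * x))
    · rw [hjν]
      exact PrimeSpectrum.localization_away_comap_range S (t * x)
  -- (B) `V.ι ≫ ρ` is an isomorphism over `D(t x)`: `ρ⁻¹(D(tx)) ⊆ ρ⁻¹(D(x)) ⊆ V`
  have hVle : ρ ⁻¹ᵁ PrimeSpectrum.basicOpen (t * x) ≤
      (σB ⁻¹ᵁ (affineBlowup.chartOpen x hxI).1).ι.opensRange := by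
    rw [Scheme.Opens.opensRange_ι]
    exact fun z hz => preimage_basicOpen_le_preimage_chart T ρ σB hσB hxI (hle_x hz)
  haveI : IsIso ((σB ⁻¹ᵁ (affineBlowup.chartOpen x hxI).1).ι ∣_ ρ ⁻¹ᵁ PrimeSpectrum.basicOpen (t * x)) :=
    isIso_morphismRestrict_of_le_opensRange _ _ hVle
  have hcomp : IsIso ((σ ≫ ν) ∣_ PrimeSpectrum.basicOpen (t * x)) := by
    rw [hν, ← hσ]
    exact isIso_morphismRestrict_comp _ ρ _
  -- (C) hence `σ` is an isomorphism over `ν⁻¹(D(t x))`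
  rw [morphismRestrict_comp] at hcomp
  haveI := hcomp
  haveI hisoσ : IsIso (σ ∣_ ν ⁻¹ᵁ PrimeSpectrum.basicOpen (t * x)) :=
    @IsIso.of_isIso_comp_right _ _ _ _ _ (σ ∣_ ν ⁻¹ᵁ PrimeSpectrum.basicOpen (t * x))
      (ν ∣_ PrimeSpectrum.basicOpen (t * x)) hisoν hcomp
  refine ⟨ν ⁻¹ᵁ PrimeSpectrum.basicOpen (t * x), ?_, ?_, hisoσ⟩
  · -- dense: `ν⁻¹(D(tx)) = D(tx)` in `Spec N`, `tx ≠ 0` in the domain `N`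
    change Dense ((Spec.map (CommRingCat.ofHom (algebraMap ↥T ↥N)) ⁻¹ᵁ
      PrimeSpectrum.basicOpen (t * x) : (Spec (.of ↥N)).Opens) : Set (Spec (.of ↥N)))
    rw [SpecMap_preimage_basicOpen]
    refine dense_basicOpen_of_ne_zero _ fun h => htx0 (hinj ?_)
    rw [map_zero]
    exact h
  · -- dense preimage: a non-empty open of the irreducible `V`
    have hpre : σ ⁻¹ᵁ (ν ⁻¹ᵁ PrimeSpectrum.basicOpen (t * x)) =
        (σB ⁻¹ᵁ (affineBlowup.chartOpen x hxI).1).ι ⁻¹ᵁ (ρ ⁻¹ᵁ PrimeSpectrum.basicOpen (t * x)) := by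
      rw [← Scheme.Hom.comp_preimage, ← Scheme.Hom.comp_preimage, hσ, hν]
    haveI : IsDominant ρ := IsBirational.isDominant ⟨U, hU, hU', hiso⟩
    obtain ⟨p, hp⟩ := (dense_basicOpen_of_ne_zero (t * x) htx0).nonempty
    obtain ⟨⟨z, hz⟩⟩ := nonempty_preimage_of_isDominant ρ (PrimeSpectrum.basicOpen (t * x)) (hV := ⟨⟨p, hp⟩⟩)
    have hzV : z ∈ σB ⁻¹ᵁ (affineBlowup.chartOpen x hxI).1 := by
      have := hVle hz
      rwa [Scheme.Opens.opensRange_ι] at this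
    haveI : Nonempty ((σB ⁻¹ᵁ (affineBlowup.chartOpen x hxI).1 : Z.Opens) : Scheme.{0}) := ⟨⟨z, hzV⟩⟩
    haveI : IsIntegral ((σB ⁻¹ᵁ (affineBlowup.chartOpen x hxI).1 : Z.Opens) : Scheme.{0}) :=
      isIntegral_of_isOpenImmersion (σB ⁻¹ᵁ (affineBlowup.chartOpen x hxI).1).ι
    rw [hpre]
    exact ((σB ⁻¹ᵁ (affineBlowup.chartOpen x hxI).1).ι ⁻¹ᵁ
      (ρ ⁻¹ᵁ PrimeSpectrum.basicOpen (t * x))).2.dense ⟨⟨z, hzV⟩, hz⟩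

end Birational

/-! ## §3 Resolutions localise (non-`∃` form of the tree's `ResolutionLocalization`) -/

section Localisation

/-- **The base change of a resolution to a localisation of the base is a resolution** (`B ⊆ S = M⁻¹B`
domains, `π : X' ⟶ Spec B` a resolution): `X' ×_{Spec B} Spec S ⟶ Spec S` is proper (base change),
birational (tree `IsBirational.pullback_snd_isLocalization`) and has regular source (the projection to `X'`
is flat and surjective on stalks, tree `Scheme.IsRegular.of_flat_of_surjectiveOnStalks`).  The statement of
the tree's `Scheme.HasResolution.of_isLocalization` with the resolution exposed. [cite: EGAIV3, 8.10.5] -/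
theorem isResolution_pullback_snd_of_isLocalization {B S : Type} [CommRing B] [CommRing S] [Algebra B S]
    (M : Submonoid B) [IsLocalization M S] [IsDomain B] [IsDomain S] {X' : Scheme.{0}}
    (π : X' ⟶ Spec (.of B)) (hπ : IsResolution π) :
    IsResolution (pullback.snd π (Spec.map (CommRingCat.ofHom (algebraMap B S)))) := by
  haveI := hπ.isProper
  haveI : IsPreimmersion (Spec.map (CommRingCat.ofHom (algebraMap B S))) :=
    IsPreimmersion.of_isLocalization M
  haveI : Flat (Spec.map (CommRingCat.ofHom (algebraMap B S))) := by
    rw [Flat.SpecMap_iff, CommRingCat.hom_ofHom, RingHom.flat_algebraMap_iff]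
    exact IsLocalization.flat S M
  exact ⟨inferInstance, hπ.isBirational.pullback_snd_isLocalization M,
    hπ.isRegular.of_flat_of_surjectiveOnStalks (pullback.fst π _)⟩

end Localisation

/-! ## §5 Assembly: the chart morphism to `Spec (nrm k[T ∪ I·x⁻¹])` is a resolution -/

section Assembly

variable (T : Subalgebra k K) {Z : Scheme.{0}} [IsIntegral Z] (ρ : Z ⟶ Spec (.of ↥T))
  (e : ↑Z.functionField ≃+* K) (he : ∀ t : ↥T, e (baseToFunctionField ρ t) = (t : K))
  {I : Ideal ↥T} (σB : Z ⟶ affineBlowup I) (hσB : σB ≫ affineBlowup.π I = ρ)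
  {x : ↥T} (hxI : x ∈ I)

include hσB in
omit [IsIntegral Z] in
/-- `V = σ_B⁻¹(D₊(xt))` is non-empty when `ρ` is dominant and `x ≠ 0` (it contains `ρ⁻¹(D(x))`). [folklore] -/
theorem preimage_chart_nonempty [IsDominant ρ] (hx0 : (x : K) ≠ 0) :
    ((σB ⁻¹ᵁ (affineBlowup.chartOpen x hxI).1 : Z.Opens) : Set Z).Nonempty := by
  have hx0' : x ≠ 0 := fun h => hx0 (by rw [h]; rfl)
  obtain ⟨p, hp⟩ := (dense_basicOpen_of_ne_zero x hx0').nonempty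
  obtain ⟨⟨z, hz⟩⟩ := nonempty_preimage_of_isDominant ρ (PrimeSpectrum.basicOpen x) (hV := ⟨⟨p, hp⟩⟩)
  exact ⟨z, preimage_basicOpen_le_preimage_chart T ρ σB hσB hxI hz⟩

include hσB he in
/-- **U2a, assembled.**  For a resolution `ρ : Z ⟶ Spec T` of the spectrum of an integrally closed
`k`-subalgebra `T ⊆ K` with `Frac T = K` (`K(Z) ≃ K` over `T`), a morphism `σ_B : Z ⟶ Bl_I(Spec T)` over
`Spec T` (e.g. `I·𝒪_Z` invertible), and `0 ≠ x ∈ I`: the open `V = σ_B⁻¹(D₊(xt))` is non-empty and carries a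
RESOLUTION `σ : V ⟶ Spec N` of the normalised affine chart ring `N = nrm (k[T ∪ I·x⁻¹])`, lying over
`Spec T`, with `σ^*(y)` of value `y`.  (Then, for `T = T_(m+1)` a tower stage and `x ∈ ca` admissible, the
base change of `σ` to `T_(m+2) = loc O N` is a resolution of the next stage:
`isResolution_pullback_snd_of_isLocalization` with `PersistenceRadicalTower.tower_succ_eq_loc_nrm_affChart`.)
[cite: StacksProject, Tags 0804, 01RN; ZariskiSamuel1960, Ch. VI §17] -/
theorem exists_isResolution_chartMorphism [IsIntegrallyClosed ↥T] [IsFractionRing ↥T K]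
    (hρ : IsResolution ρ) (hx0 : (x : K) ≠ 0) :
    ∃ (hne : ((σB ⁻¹ᵁ (affineBlowup.chartOpen x hxI).1 : Z.Opens) : Set Z).Nonempty)
      (σ : ((σB ⁻¹ᵁ (affineBlowup.chartOpen x hxI).1 : Z.Opens) : Scheme.{0}) ⟶ Spec (.of ↥(nrm (Algebra.adjoin k ((T : Set K) ∪ {y : K | ∃ c : ↥T, c ∈ I ∧ y = (c : K) * (x : K)⁻¹}))))),
      (∀ y, e (Z.presheaf.germ _ (genericPoint Z)
          (genericPoint_mem_image_top (σB ⁻¹ᵁ (affineBlowup.chartOpen x hxI).1) hne)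
          (σ.appTop ((Scheme.ΓSpecIso (.of ↥(nrm (Algebra.adjoin k ((T : Set K) ∪ {y : K | ∃ c : ↥T, c ∈ I ∧ y = (c : K) * (x : K)⁻¹}))))).inv y))) = (y : K)) ∧
      (σB ⁻¹ᵁ (affineBlowup.chartOpen x hxI).1).ι ≫ ρ =
        σ ≫ Spec.map (CommRingCat.ofHom (Subalgebra.inclusion (le_nrm_adjoin T (I := I) (x := x))).toRingHom) ∧
      IsResolution σ := by
  haveI := hρ.isProper
  haveI : IsDominant ρ := hρ.isBirational.isDominant
  have hne := preimage_chart_nonempty T ρ σB hσB hxI hx0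
  -- the hypotheses of `exists_chartMorphism` for `N = nrm C`
  have hTN := le_nrm_adjoin T (I := I) (x := x)
  have hIN : ∀ c : ↥T, c ∈ I → (c : K) * (x : K)⁻¹ ∈ (nrm (Algebra.adjoin k ((T : Set K) ∪ {y : K | ∃ c : ↥T, c ∈ I ∧ y = (c : K) * (x : K)⁻¹}))) := by
    intro c hc
    have h : (c : K) * (x : K)⁻¹ ∈ (Algebra.adjoin k ((T : Set K) ∪ {y : K | ∃ c : ↥T, c ∈ I ∧ y = (c : K) * (x : K)⁻¹})) := Algebra.subset_adjoin (Or.inr ⟨c, hc, rfl⟩)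
    exact Algebra.subset_adjoin (isIntegral_algebraMap (A := K) (x := (⟨_, h⟩ : ↥(Algebra.adjoin k ((T : Set K) ∪ {y : K | ∃ c : ↥T, c ∈ I ∧ y = (c : K) * (x : K)⁻¹})))))
  obtain ⟨τ, hτ, -⟩ := exists_chartHom T ρ σB hσB hxI
  have hNz : ∀ z ∈ (σB ⁻¹ᵁ (affineBlowup.chartOpen x hxI).1), ∀ y ∈ (nrm (Algebra.adjoin k ((T : Set K) ∪ {y : K | ∃ c : ↥T, c ∈ I ∧ y = (c : K) * (x : K)⁻¹}))), y ∈ ((RatFn.toFunctionField z).range).map e.toRingHom := by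
    intro z hz y hy
    haveI := hρ.isRegular z
    exact nrm_adjoin_le_stalkSubring T ρ e he σB hσB hxI τ hτ hx0 z hz hy
  obtain ⟨σ, hσv, hσc, hσp⟩ := exists_chartMorphism T ρ e he σB hσB hxI hx0 hne (nrm (Algebra.adjoin k ((T : Set K) ∪ {y : K | ∃ c : ↥T, c ∈ I ∧ y = (c : K) * (x : K)⁻¹}))) hTN hIN hNz
  refine ⟨hne, σ, hσv, hσc, hσp, ?_, ?_⟩
  · exact isBirational_of_comp_eq T ρ σB hσB hxI hρ.isBirational hx0 (nrm (Algebra.adjoin k ((T : Set K) ∪ {y : K | ∃ c : ↥T, c ∈ I ∧ y = (c : K) * (x : K)⁻¹}))) hTN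
      (fun y hy => exists_pow_mul_mem_of_mem_nrm_adjoin T hx0 hy) σ hσc
  · -- an open subscheme of the regular `Z` is regular
    intro v
    haveI := hρ.isRegular ((σB ⁻¹ᵁ (affineBlowup.chartOpen x hxI).1).ι v)
    exact IsRegularLocalRing.of_ringEquiv
      (asIso (((σB ⁻¹ᵁ (affineBlowup.chartOpen x hxI).1).ι).stalkMap v)).commRingCatIsoToRingEquiv

end Assembly

/-! ## §6 The generator sets in tower vocabulary -/

section Bridge

/-- The generators `c · x⁻¹`, `c ∈ ca T` (the tree's tower vocabulary, `ca T ⊆ K`) are the `c · x⁻¹` for `c`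
in the cohomology-annihilator IDEAL of `↥T` (tree `tn_coe_mem_ca_iff`). [folklore] -/
theorem setOf_ca_mul_inv_eq (T : Subalgebra k K) (x : K) :
    {y : K | ∃ c ∈ ca T, y = c * x⁻¹} =
      {y : K | ∃ c : ↥T, c ∈ Literature.RingTheory.CohomologyAnnihilator.cohomologyAnnihilator ↥T ∧
        y = (c : K) * x⁻¹} := by
  ext y
  constructor
  · rintro ⟨c, hc, rfl⟩
    exact ⟨⟨c, ca_subset T hc⟩, (tn_coe_mem_ca_iff T ⟨c, ca_subset T hc⟩).mp hc, rfl⟩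
  · rintro ⟨c, hc, rfl⟩
    exact ⟨c, (tn_coe_mem_ca_iff T c).mpr hc, rfl⟩

end Bridge

end Summit.ResolutionOfSingularities.ResolutionOfSingularities.Theorems.SurfaceTermination.ChartResolution

end
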